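import Mathlib
import HarnessLib

/-!
# Route `KLProgramme` — crux C4a, S3 brick (B4) «(U1)-M-LAW» part 1 (5b-M): the PRE-CAUSTIC LEVEL LINE for a COMPARABLE-LEVELS kernel piece — no flat zone
# (`hsupp` absent); instead the comparability support (partner `≥ q_c×` coarser ⟹ `(K e)′ = 0`), a flatness row on the BAND of the line, a whole-line second-order
# deviation row with a line datum `c₁`, and a decay row on opposite-sign comparable levels; bound
# `X₀·A_t + W·(16C³X₀·c₁/D + 64C³X₀·K_d + 16C²X₁·1 + X₀C_t·lo/max(D,lo)²)`, `C = q_c + 3/2`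

Cell `gate-hubbard-kl`, seat hubbard-kl-k3c3-p3 (g34; row «implicit-function / monotonicity route for μ(n)»).  Located brick for the (C)-closer lane / the (M4)
assembly of the umklapp first-order ϑ-layer (stub (C) `stub_twoLeg_curvature` of `KLRegimeEngineV17F2`, stmt-HubbardSuperconductivity-20437); answers the pen's
(R362) routing of k3c3-p1 g16's «PARTITION-CLOSURE» (q1): the true pp kernel splits as `P = A + A′ + M` (`…C4aPPKernelPartition`, p697995); `A` (partner far) meets
the primed law rows, `A′` is `A` after the zone-box swap, and the comparable-levels piece `M` (both lines within the factor `q_c = (2−t₁)/t₁ ≥ 4` of each other) has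
NO flat zone, so `…C4aPreCausticLevelLineSplitAbs` (5b′, whose `hsupp` kills the loop levels `e ≥ κD`) cannot take it.  Memo HOME/hubbard-kl-k3c3-p3/U1-CAUSTIC-SUP.md §17.

THE LAW (pure real analysis, sizes binder shape of 5b′).  Line: loop levels `e ∈ [lo, hi]`, anti-diagonal level `D > 0`, partner line `ē(e)` with
`|ē(e) − (D − e)| ≤ e/2` and `≤ c₁·e + K_d·e²` (the fold-box geometry: `c₁ = K₂·msD_ρ·dist_caustic(y)`, `K_d = K₂·msD_ρ²` — a LINE datum and an n-free constant).
Three ranges: (V) `e ≤ κ₁D`, `κ₁ = 1/(q_c + 3/2)`: the partner `ē ≥ D − 3e/2 ≥ q_c·e` is `q_c×` coarser ⟹ the integrand VANISHES (`hcomp`); (B) the band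
`κ₁D ≤ e ≤ 4D`: the deformed anti-diagonal comparison (§1, anchor `lo` outside the band) with envelopes floored by `e ≥ κ₁D` (`|∂ᵤK| ≤ (C/D)²`, `|∂ᵤ²K| ≤ (C/D)³`,
`C = q_c + 3/2`), the band flatness `|∫_B w·∂ᵤK(e, D−e)| ≤ A_t` (`hflatB`, asked on the band `B = [max(lo,D/C), min(hi,4D)]` ONLY — below it the piece vanishes, above it it is thermally small, so for `M` it is the full-line flatness of `P − A − A′` by linearity up to the tail), deviation `≤ 4c₁D + 16K_dD²`, X-variation anchored at `lo`;
(T) the tail `e ≥ 4D`: there `ē ≤ D − e/2 ≤ −e/4` (opposite-sign comparable levels) and the DECAY row `|∂ᵤK(e,u)| ≤ C_t·lo/max(e,|u|)³` (`hKopp`; thermal saturation of the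
pp numerator on `{e + u ≈ D}`, k3c3-p1's remark) gives `∫_T ≤ W·X₀·C_t·lo/(2·max(lo,4D)²) ≤ W·X₀·C_t·lo/max(D,lo)²` — the SAME shape as the flatness slot `A_fl·lo/max(D,lo)²`
of 5c, so the angle layer consumes it unchanged; the new per-line term `c₁(y)/D(y)` integrates over the loop window to the pre law's `log⁺(Γ/δ₀)` currency (part 2, 5c-M).
* §1 `abs_intervalIntegral_deformed_antidiagonal_le_anchor` — `…Split`'s comparison lemma with the `X`-Lipschitz anchor `e₀ ≤ a` OUTSIDE the range (factor `b − e₀`).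
* §2 `intervalIntegral_inv_cube_le` (`∫_a^b lo/e³ ≤ lo/(2a²)`), **`abs_intervalIntegral_levelLine_middle_le`** (HEADLINE).
Pure real analysis; nothing about the model; nothing asserts (C), K3 or superconductivity.
References: FST II CPAM 51 (1998) §3 [cite: FeldmanSalmhoferTrubowitz1998]; Salmhofer 1999 §4.5.3 [cite: Salmhofer1999].
-/

noncomputable section

namespace Summit.HubbardSuperconductivity.HubbardSuperconductivity.Theorems.C4a

set_option linter.dupNamespace false -- summit = problem name (single-conjunct summit), D-0017

open Real Set MeasureTheory intervalIntegral
open scoped Interval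

/-! ## §1 The deformed anti-diagonal with an outside anchor -/

/-- **Comparison along a deformed anti-diagonal, anchor outside the range**: as `…C4aPreCausticLevelLineSplit.abs_intervalIntegral_deformed_antidiagonal_le_unif`
but the `X`-Lipschitz row is anchored at `e₀ ≤ a` (so `|X e − X e₀| ≤ X₁(b − e₀)` on `[a,b]`):
`|∫_a^b w·X·Ku(D−e+r)| ≤ X₀·A_fl + W·(X₀·B₂·ρ + X₁·B₁·(b − e₀))·(b − a)`. -/
theorem abs_intervalIntegral_deformed_antidiagonal_le_anchor {Ku : ℝ → ℝ → ℝ} {w X r : ℝ → ℝ} {a b e₀ D W X₀ X₁ ρ B₁ B₂ Afl : ℝ}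
    (hab : a ≤ b) (he₀ : e₀ ≤ a) (hX00 : 0 ≤ X₀) (hW0 : 0 ≤ W) (hB₂0 : 0 ≤ B₂) (hX₁ : 0 ≤ X₁)
    (hfi : IntervalIntegrable (fun e => w e * X e * Ku e (D - e + r e)) volume a b)
    (hgi : IntervalIntegrable (fun e => w e * Ku e (D - e)) volume a b)
    (hw0 : ∀ e ∈ Icc a b, 0 ≤ w e) (hwW : ∀ e ∈ Icc a b, w e ≤ W)
    (hX0 : ∀ e ∈ Icc a b, |X e| ≤ X₀) (hXe₀ : |X e₀| ≤ X₀) (hX1 : ∀ e ∈ Icc a b, |X e - X e₀| ≤ X₁ * |e - e₀|)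
    (hr : ∀ e ∈ Icc a b, |r e| ≤ ρ)
    (hB₁ : ∀ e ∈ Icc a b, |Ku e (D - e)| ≤ B₁)
    (hB₂ : ∀ e ∈ Icc a b, ∀ u : ℝ, |Ku e u - Ku e (D - e)| ≤ B₂ * |u - (D - e)|)
    (hflat : |∫ e in a..b, w e * Ku e (D - e)| ≤ Afl) :
    |∫ e in a..b, w e * X e * Ku e (D - e + r e)| ≤ X₀ * Afl + W * (X₀ * B₂ * ρ + X₁ * B₁ * (b - e₀)) * (b - a) := by
  have hpt : ∀ e ∈ Ι a b, ‖w e * X e * Ku e (D - e + r e) - X e₀ * (w e * Ku e (D - e))‖ ≤ W * (X₀ * B₂ * ρ + X₁ * B₁ * (b - e₀)) := by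
    intro e he
    rw [uIoc_of_le hab] at he
    have heI : e ∈ Icc a b := Ioc_subset_Icc_self he
    have hee₀ : |e - e₀| ≤ b - e₀ := by
      rw [abs_le]; constructor <;> linarith [heI.1, heI.2, he₀]
    have hK2 := hB₂ e heI (D - e + r e)
    rw [show D - e + r e - (D - e) = r e by ring] at hK2
    have hsplit : w e * X e * Ku e (D - e + r e) - X e₀ * (w e * Ku e (D - e)) =
        w e * (X e * (Ku e (D - e + r e) - Ku e (D - e)) + (X e - X e₀) * Ku e (D - e)) := by ring
    rw [hsplit, Real.norm_eq_abs, abs_mul, abs_of_nonneg (hw0 e heI)]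
    have h1 : |X e * (Ku e (D - e + r e) - Ku e (D - e))| ≤ X₀ * (B₂ * ρ) := by
      rw [abs_mul]
      exact mul_le_mul (hX0 e heI) (hK2.trans (mul_le_mul_of_nonneg_left (hr e heI) hB₂0)) (abs_nonneg _) hX00
    have h2 : |(X e - X e₀) * Ku e (D - e)| ≤ X₁ * (b - e₀) * B₁ := by
      rw [abs_mul]
      have hX1' : |X e - X e₀| ≤ X₁ * (b - e₀) := (hX1 e heI).trans (mul_le_mul_of_nonneg_left hee₀ hX₁)
      exact mul_le_mul hX1' (hB₁ e heI) (abs_nonneg _) ((abs_nonneg _).trans hX1')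
    calc w e * |X e * (Ku e (D - e + r e) - Ku e (D - e)) + (X e - X e₀) * Ku e (D - e)|
        ≤ W * (X₀ * (B₂ * ρ) + X₁ * (b - e₀) * B₁) :=
          mul_le_mul (hwW e heI) ((abs_add_le _ _).trans (add_le_add h1 h2)) (abs_nonneg _) hW0
      _ = W * (X₀ * B₂ * ρ + X₁ * B₁ * (b - e₀)) := by ring
  have hdiff := intervalIntegral.norm_integral_le_of_norm_le_const hpt
  rw [intervalIntegral.integral_sub hfi (hgi.const_mul (X e₀)), intervalIntegral.integral_const_mul, Real.norm_eq_abs,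
    abs_of_nonneg (sub_nonneg.2 hab)] at hdiff
  have hmain : |∫ e in a..b, w e * X e * Ku e (D - e + r e)| ≤
      |X e₀ * ∫ e in a..b, w e * Ku e (D - e)| + W * (X₀ * B₂ * ρ + X₁ * B₁ * (b - e₀)) * (b - a) := by
    have h := abs_sub_abs_le_abs_sub (∫ e in a..b, w e * X e * Ku e (D - e + r e)) (X e₀ * ∫ e in a..b, w e * Ku e (D - e))
    linarith
  refine hmain.trans ?_
  rw [abs_mul]
  have h3 : |X e₀| * |∫ e in a..b, w e * Ku e (D - e)| ≤ X₀ * Afl := mul_le_mul hXe₀ hflat (abs_nonneg _) hX00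
  linarith

/-! ## §2 The comparable-levels level line -/

/-- `∫_a^b lo/e³ de ≤ lo/(2a²)` for `0 < a ≤ b`, `0 ≤ lo`. [folklore] -/
theorem intervalIntegral_inv_cube_le {a b lo : ℝ} (ha : 0 < a) (hab : a ≤ b) (hlo : 0 ≤ lo) :
    ∫ e in a..b, lo / e ^ 3 ≤ lo / (2 * a ^ 2) := by
  have hderiv : ∀ e ∈ uIcc a b, HasDerivAt (fun e : ℝ => -(lo / 2) * (e ^ 2)⁻¹) (lo / e ^ 3) e := fun e he => by
    rw [uIcc_of_le hab] at he
    have he0 : e ≠ 0 := (ha.trans_le he.1).ne'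
    have h1 : HasDerivAt (fun e : ℝ => e ^ 2) (2 * e) e := by simpa using hasDerivAt_pow 2 e
    have h2 : HasDerivAt (fun e : ℝ => (e ^ 2)⁻¹) (-(2 * e) / (e ^ 2) ^ 2) e := h1.inv (pow_ne_zero 2 he0)
    have h3 : HasDerivAt (fun e : ℝ => -(lo / 2) * (e ^ 2)⁻¹) (-(lo / 2) * (-(2 * e) / (e ^ 2) ^ 2)) e := h2.const_mul _
    refine h3.congr_deriv ?_
    field_simp
  have hcont : ContinuousOn (fun e : ℝ => lo / e ^ 3) (uIcc a b) := by
    refine continuousOn_const.div (continuousOn_pow 3) fun e he => ?_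
    rw [uIcc_of_le hab] at he
    exact pow_ne_zero 3 (ha.trans_le he.1).ne'
  rw [intervalIntegral.integral_eq_sub_of_hasDerivAt hderiv (hcont.intervalIntegrable)]
  have hb2 : 0 ≤ lo / 2 * (b ^ 2)⁻¹ := by positivity
  have e1 : -(lo / 2) * (a ^ 2)⁻¹ = -(lo / (2 * a ^ 2)) := by ring
  nlinarith [hb2, e1, inv_nonneg.2 (sq_nonneg b)]

set_option maxHeartbeats 400000 in
/-- **THE PRE-CAUSTIC LEVEL LINE FOR A COMPARABLE-LEVELS KERNEL PIECE** (HEADLINE; see the module docstring).  Levels `0 < lo ≤ hi`, anti-diagonal level `D > 0`,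
comparability ratio `q_c ≥ 4`, `C := q_c + 3/2`.  Kernel `K e ∈ C²` (`e ∈ [lo,hi]`) with the envelopes `|∂ᵤK| ≤ 1/max(e,|u|)²`, `|∂ᵤ²K| ≤ 1/max(e,|u|)³`, the
comparability support `q_c·e ≤ |u| ⟹ ∂ᵤK(e,u) = 0`, the opposite-sign decay `u ≤ −e/4 ⟹ |∂ᵤK(e,u)| ≤ C_t·lo/max(e,|u|)³`, the band flatness
`|∫_{max(lo,D/C)}^{min(hi,4D)} w·∂ᵤK(e,D−e)| ≤ A_t` on THE BAND; weight `|X| ≤ X₀`, `|X e − X lo| ≤ X₁(e − lo)`; profile `0 ≤ w ≤ W`; the partner line with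
`|ē − (D−e)| ≤ e/2` and `≤ c₁e + K_de²`; integrability of the line integrand on `[lo,hi]`.  THEN
`|∫_{lo}^{hi} w·X·∂ᵤK(e, ē e) de| ≤ X₀·A_t + W·(16C³X₀·(c₁/D) + 64C³X₀·K_d + 16C²X₁) + W·X₀·C_t·(lo/max(D,lo)²)`. -/
theorem abs_intervalIntegral_levelLine_middle_le {K : ℝ → ℝ → ℝ} {w X eb : ℝ → ℝ} {lo hi D qc X₀ X₁ W At c₁ Kd Ct : ℝ}
    (hlo : 0 < lo) (hlohi : lo ≤ hi) (hD : 0 < D) (hqc : 4 ≤ qc) (hX₁ : 0 ≤ X₁) (hc₁ : 0 ≤ c₁) (hKd : 0 ≤ Kd) (hCt : 0 ≤ Ct) (hAt : 0 ≤ At)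
    (hK : ∀ e ∈ Icc lo hi, ContDiff ℝ 2 (K e)) (hK1 : ∀ e ∈ Icc lo hi, ∀ u, |deriv (K e) u| ≤ (max e |u|)⁻¹ ^ 2)
    (hK2 : ∀ e ∈ Icc lo hi, ∀ u, |iteratedDeriv 2 (K e) u| ≤ (max e |u|)⁻¹ ^ 3)
    (hcomp : ∀ e ∈ Icc lo hi, ∀ u, qc * e ≤ |u| → deriv (K e) u = 0)
    (hKopp : ∀ e ∈ Icc lo hi, ∀ u, u ≤ -(e / 4) → |deriv (K e) u| ≤ Ct * lo * (max e |u|)⁻¹ ^ 3)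
    (hflatB : |∫ e in (max lo (D / (qc + 3 / 2)))..(min hi (4 * D)), w e * deriv (K e) (D - e)| ≤ At)
    (hfi : IntervalIntegrable (fun e => w e * X e * deriv (K e) (eb e)) volume lo hi)
    (hgi : IntervalIntegrable (fun e => w e * deriv (K e) (D - e)) volume lo hi)
    (hw0 : ∀ e ∈ Icc lo hi, 0 ≤ w e) (hwW : ∀ e ∈ Icc lo hi, w e ≤ W)
    (hX0 : ∀ e ∈ Icc lo hi, |X e| ≤ X₀) (hXL : ∀ e ∈ Icc lo hi, |X e - X lo| ≤ X₁ * |e - lo|)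
    (hdev : ∀ e ∈ Icc lo hi, |eb e - (D - e)| ≤ e / 2) (hdev2 : ∀ e ∈ Icc lo hi, |eb e - (D - e)| ≤ c₁ * e + Kd * e ^ 2) :
    |∫ e in lo..hi, w e * X e * deriv (K e) (eb e)| ≤
      X₀ * At + W * (16 * (qc + 3 / 2) ^ 3 * X₀ * (c₁ / D) + 64 * (qc + 3 / 2) ^ 3 * X₀ * Kd + 16 * (qc + 3 / 2) ^ 2 * X₁) +
        W * X₀ * Ct * (lo / (max D lo) ^ 2) := by
  have hloI : lo ∈ Icc lo hi := left_mem_Icc.2 hlohi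
  have hX00 : 0 ≤ X₀ := (abs_nonneg _).trans (hX0 lo hloI)
  have hW0 : 0 ≤ W := (hw0 lo hloI).trans (hwW lo hloI)
  set C : ℝ := qc + 3 / 2 with hC
  have hC0 : 0 < C := by rw [hC]; linarith
  have hC1 : 1 ≤ C := by rw [hC]; linarith
  -- the three constants of the bound are nonnegative
  have hband0 : 0 ≤ W * (16 * C ^ 3 * X₀ * (c₁ / D) + 64 * C ^ 3 * X₀ * Kd + 16 * C ^ 2 * X₁) := by positivity
  have htail0 : 0 ≤ W * X₀ * Ct * (lo / (max D lo) ^ 2) := by positivity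
  have hAt0 : 0 ≤ X₀ * At := by positivity
  -- integrability on sub-ranges
  have hsubI : ∀ p q, lo ≤ p → p ≤ q → q ≤ hi → IntervalIntegrable (fun e => w e * X e * deriv (K e) (eb e)) volume p q := fun p q hp hpq hq =>
    hfi.mono_set (by rw [uIcc_of_le hlohi, uIcc_of_le hpq]; exact Icc_subset_Icc hp hq)
  have hsubI' : ∀ p q, lo ≤ p → p ≤ q → q ≤ hi → IntervalIntegrable (fun e => w e * deriv (K e) (D - e)) volume p q := fun p q hp hpq hq =>
    hgi.mono_set (by rw [uIcc_of_le hlohi, uIcc_of_le hpq]; exact Icc_subset_Icc hp hq)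
  -- (T) the tail integrand is dominated by `W X₀ C_t lo/e³` for `e ≥ 4D`
  have htail_pt : ∀ e ∈ Icc lo hi, 4 * D ≤ e → |w e * X e * deriv (K e) (eb e)| ≤ W * X₀ * Ct * (lo / e ^ 3) := by
    intro e he h4
    have he0 : 0 < e := hlo.trans_le he.1
    have hdv := (abs_le.1 (hdev e he)).2
    have hu : eb e ≤ -(e / 4) := by linarith
    have h1 := hKopp e he (eb e) hu
    have hm : e ≤ max e |eb e| := le_max_left _ _
    have h2 : Ct * lo * (max e |eb e|)⁻¹ ^ 3 ≤ Ct * lo * (e⁻¹ ^ 3) := by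
      refine mul_le_mul_of_nonneg_left ?_ (by positivity)
      exact pow_le_pow_left₀ (by positivity) (inv_anti₀ he0 hm) 3
    rw [abs_mul, abs_mul, abs_of_nonneg (hw0 e he)]
    have h3 : |deriv (K e) (eb e)| ≤ Ct * (lo / e ^ 3) := by
      refine h1.trans (h2.trans (le_of_eq ?_))
      rw [div_eq_mul_inv, ← inv_pow]; ring
    calc w e * |X e| * |deriv (K e) (eb e)| ≤ W * X₀ * (Ct * (lo / e ^ 3)) :=
          mul_le_mul (mul_le_mul (hwW e he) (hX0 e he) (abs_nonneg _) hW0) h3 (abs_nonneg _) (by positivity)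
      _ = W * X₀ * Ct * (lo / e ^ 3) := by ring
  have htail : ∀ p, lo ≤ p → p ≤ hi → 4 * D ≤ p → |∫ e in p..hi, w e * X e * deriv (K e) (eb e)| ≤ W * X₀ * Ct * (lo / (2 * p ^ 2)) := by
    intro p hp hphi h4
    have hp0 : 0 < p := hlo.trans_le hp
    have hdom : ∀ᵐ e ∂volume, e ∈ Ioc p hi → ‖w e * X e * deriv (K e) (eb e)‖ ≤ W * X₀ * Ct * (lo / e ^ 3) :=
      Filter.Eventually.of_forall fun e he => by
        rw [Real.norm_eq_abs]; exact htail_pt e ⟨hp.trans he.1.le, he.2⟩ (h4.trans he.1.le)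
    have hgc : ContinuousOn (fun e : ℝ => W * X₀ * Ct * (lo / e ^ 3)) (uIcc p hi) := by
      refine continuousOn_const.mul (continuousOn_const.div (continuousOn_pow 3) fun e he => ?_)
      rw [uIcc_of_le hphi] at he
      exact pow_ne_zero 3 (hp0.trans_le he.1).ne'
    have h := intervalIntegral.norm_integral_le_of_norm_le hphi hdom hgc.intervalIntegrable
    rw [Real.norm_eq_abs] at h
    refine h.trans ?_
    rw [intervalIntegral.integral_const_mul]
    exact mul_le_mul_of_nonneg_left (intervalIntegral_inv_cube_le hp0 hphi hlo.le) (by positivity)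
  -- kernel facts on levels `e ≥ D/C`: envelopes floored by `C/D`
  have henv1 : ∀ e ∈ Icc lo hi, D / C ≤ e → |deriv (K e) (D - e)| ≤ (C / D) ^ 2 := fun e he hge => by
    have he0 : 0 < e := hlo.trans_le he.1
    have hDC : 0 < D / C := div_pos hD hC0
    refine (hK1 e he (D - e)).trans ?_
    have hm : D / C ≤ max e |D - e| := hge.trans (le_max_left _ _)
    have h1 : (max e |D - e|)⁻¹ ≤ (D / C)⁻¹ := inv_anti₀ hDC hm
    rw [show (C / D) = (D / C)⁻¹ from (inv_div D C).symm]
    exact pow_le_pow_left₀ (by positivity) h1 2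
  have henv2 : ∀ e ∈ Icc lo hi, D / C ≤ e → ∀ u : ℝ, |deriv (K e) u - deriv (K e) (D - e)| ≤ (C / D) ^ 3 * |u - (D - e)| := by
    intro e he hge u
    have he0 : 0 < e := hlo.trans_le he.1
    have hDC : 0 < D / C := div_pos hD hC0
    have hKe := hK e he
    have hdiff : Differentiable ℝ (deriv (K e)) := by
      have h : Differentiable ℝ (iteratedDeriv 1 (K e)) := ContDiff.differentiable_iteratedDeriv 1 hKe (by norm_num)
      rwa [iteratedDeriv_one] at h
    have hd2 : ∀ x, deriv (deriv (K e)) x = iteratedDeriv 2 (K e) x := fun x => by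
      rw [show iteratedDeriv 2 (K e) = deriv (iteratedDeriv 1 (K e)) from iteratedDeriv_succ, iteratedDeriv_one]
    have hseg : ∀ x ∈ uIcc (D - e) u, ‖deriv (deriv (K e)) x‖ ≤ (C / D) ^ 3 := fun x _ => by
      rw [Real.norm_eq_abs, hd2]
      refine (hK2 e he x).trans ?_
      have hm : D / C ≤ max e |x| := hge.trans (le_max_left _ _)
      have h1 : (max e |x|)⁻¹ ≤ (D / C)⁻¹ := inv_anti₀ hDC hm
      rw [show (C / D) = (D / C)⁻¹ from (inv_div D C).symm]
      exact pow_le_pow_left₀ (by positivity) h1 3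
    have hmvt := Convex.norm_image_sub_le_of_norm_deriv_le (fun x _ => hdiff.differentiableAt) hseg
      (convex_uIcc (D - e) u) left_mem_uIcc right_mem_uIcc
    rwa [Real.norm_eq_abs, Real.norm_eq_abs] at hmvt
  -- the vanishing below `D/C`: the partner is `q_c×` coarser
  have hvan : ∀ e ∈ Icc lo hi, e ≤ D / C → deriv (K e) (eb e) = 0 := fun e he hev => by
    have he0 : 0 < e := hlo.trans_le he.1
    have hdv := (abs_le.1 (hdev e he)).1
    have h1 : C * e ≤ D := by rwa [le_div_iff₀ hC0, mul_comm] at hev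
    have h2 : qc * e ≤ eb e := by rw [hC] at h1; nlinarith
    exact hcomp e he (eb e) (h2.trans (le_abs_self _))
  -- CASE 1: the whole line is tail (`4D < lo`)
  rcases lt_or_ge (4 * D) lo with hsmall | hbig
  · have h := htail lo le_rfl hlohi hsmall.le
    have hmax : lo / (2 * lo ^ 2) ≤ lo / (max D lo) ^ 2 := by
      have hDlo : D ≤ lo := by linarith
      rw [max_eq_right hDlo]
      exact div_le_div_of_nonneg_left hlo.le (by positivity) (by nlinarith)
    have h' : W * X₀ * Ct * (lo / (2 * lo ^ 2)) ≤ W * X₀ * Ct * (lo / (max D lo) ^ 2) := mul_le_mul_of_nonneg_left hmax (by positivity)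
    linarith [h, h', hband0, hAt0]
  -- CASE 2a: the whole line vanishes (`hi < D/C`)
  rcases lt_or_ge hi (D / C) with hhiC | hhiC
  · have hzero : ∫ e in lo..hi, w e * X e * deriv (K e) (eb e) = 0 := by
      rw [← intervalIntegral.integral_zero (a := lo) (b := hi)]
      refine intervalIntegral.integral_congr fun e he => ?_
      rw [uIcc_of_le hlohi] at he
      simp only [hvan e he (he.2.trans hhiC.le), mul_zero]
    rw [hzero, abs_zero]; linarith [hband0, htail0, hAt0]
  -- CASE 2b: `lo ≤ 4D`, `D/C ≤ hi`; split points `v = max lo (D/C) ≤ t = min hi (4D)`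
  set v : ℝ := max lo (D / C) with hv
  set t : ℝ := min hi (4 * D) with ht
  have hκ4 : D / C ≤ 4 * D := by rw [div_le_iff₀ hC0]; nlinarith
  have hlov : lo ≤ v := le_max_left _ _
  have hvC : D / C ≤ v := le_max_right _ _
  have hvt : v ≤ t := le_min (max_le hlohi hhiC) (max_le hbig hκ4)
  have hthi : t ≤ hi := min_le_left _ _
  have ht4 : t ≤ 4 * D := min_le_right _ _
  have hvhi : v ≤ hi := hvt.trans hthi
  have hlot : lo ≤ t := hlov.trans hvt
  -- (V) `[lo, v]`
  have hV : ∫ e in lo..v, w e * X e * deriv (K e) (eb e) = 0 := by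
    rcases le_or_gt (D / C) lo with hle | hgt
    · have hveq : v = lo := by rw [hv, max_eq_left hle]
      rw [hveq, intervalIntegral.integral_same]
    · have hveq : v = D / C := by rw [hv, max_eq_right hgt.le]
      rw [← intervalIntegral.integral_zero (a := lo) (b := v)]
      refine intervalIntegral.integral_congr fun e he => ?_
      rw [uIcc_of_le hlov] at he
      simp only [hvan e ⟨he.1, he.2.trans hvhi⟩ (hveq ▸ he.2), mul_zero]
  -- (B) `[v, t]`: the deformed anti-diagonal with anchor `lo`
  have hBsub : Icc v t ⊆ Icc lo hi := Icc_subset_Icc hlov hthi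
  have hfiB : IntervalIntegrable (fun e => w e * X e * (fun e u => deriv (K e) u) e (D - e + (eb e - (D - e)))) volume v t := by
    simpa only [show ∀ e, D - e + (eb e - (D - e)) = eb e from fun e => by ring] using hsubI v t hlov hvt hthi
  have hB := abs_intervalIntegral_deformed_antidiagonal_le_anchor (Ku := fun e u => deriv (K e) u) (r := fun e => eb e - (D - e))
    (ρ := c₁ * (4 * D) + Kd * (4 * D) ^ 2) (B₁ := (C / D) ^ 2) (B₂ := (C / D) ^ 3) (Afl := At) (X₀ := X₀) (X₁ := X₁) (W := W) (e₀ := lo)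
    hvt hlov hX00 hW0 (by positivity) hX₁ hfiB (hsubI' v t hlov hvt hthi)
    (fun e he => hw0 e (hBsub he)) (fun e he => hwW e (hBsub he)) (fun e he => hX0 e (hBsub he)) (hX0 lo hloI) (fun e he => hXL e (hBsub he))
    (fun e he => by
      have heI := hBsub he
      have he0 : 0 ≤ e := hlo.le.trans heI.1
      have het : e ≤ 4 * D := he.2.trans ht4
      refine (hdev2 e heI).trans ?_
      have h1 : c₁ * e ≤ c₁ * (4 * D) := mul_le_mul_of_nonneg_left het hc₁
      have h2 : Kd * e ^ 2 ≤ Kd * (4 * D) ^ 2 := mul_le_mul_of_nonneg_left (pow_le_pow_left₀ he0 het 2) hKd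
      linarith)
    (fun e he => henv1 e (hBsub he) (hvC.trans he.1)) (fun e he u => henv2 e (hBsub he) (hvC.trans he.1) u)
    hflatB
  simp only [show ∀ e, D - e + (eb e - (D - e)) = eb e from fun e => by ring] at hB
  -- simplify the band bound: `t − v ≤ 4D`, `t − lo ≤ 4D`
  have htv : t - v ≤ 4 * D := by linarith [hlov, ht4, hlo]
  have htlo : t - lo ≤ 4 * D := by linarith [ht4, hlo]
  have htv0 : 0 ≤ t - v := sub_nonneg.2 hvt
  have hinner0 : 0 ≤ X₀ * (C / D) ^ 3 * (c₁ * (4 * D) + Kd * (4 * D) ^ 2) + X₁ * (C / D) ^ 2 * (t - lo) := by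
    have : 0 ≤ t - lo := sub_nonneg.2 hlot
    positivity
  have hBle : X₀ * At + W * (X₀ * (C / D) ^ 3 * (c₁ * (4 * D) + Kd * (4 * D) ^ 2) + X₁ * (C / D) ^ 2 * (t - lo)) * (t - v) ≤
      X₀ * At + W * (16 * C ^ 3 * X₀ * (c₁ / D) + 64 * C ^ 3 * X₀ * Kd + 16 * C ^ 2 * X₁) := by
    have h1 : X₀ * (C / D) ^ 3 * (c₁ * (4 * D) + Kd * (4 * D) ^ 2) + X₁ * (C / D) ^ 2 * (t - lo) ≤
        X₀ * (C / D) ^ 3 * (c₁ * (4 * D) + Kd * (4 * D) ^ 2) + X₁ * (C / D) ^ 2 * (4 * D) := by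
      have := mul_le_mul_of_nonneg_left htlo (show 0 ≤ X₁ * (C / D) ^ 2 by positivity); linarith
    have h2 := mul_le_mul h1 htv htv0 (by positivity)
    have hD0 : D ≠ 0 := hD.ne'
    have h3 : (X₀ * (C / D) ^ 3 * (c₁ * (4 * D) + Kd * (4 * D) ^ 2) + X₁ * (C / D) ^ 2 * (4 * D)) * (4 * D) =
        16 * C ^ 3 * X₀ * (c₁ / D) + 64 * C ^ 3 * X₀ * Kd + 16 * C ^ 2 * X₁ := by
      rw [div_pow, div_pow]
      field_simp
      ring
    have h4 := mul_le_mul_of_nonneg_left h2 hW0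
    rw [h3] at h4
    linarith
  -- (T) `[t, hi]`
  have hT : |∫ e in t..hi, w e * X e * deriv (K e) (eb e)| ≤ W * X₀ * Ct * (lo / (max D lo) ^ 2) := by
    rcases le_or_gt (4 * D) hi with h4 | h4
    · have hteq : t = 4 * D := by rw [ht, min_eq_right h4]
      have h := htail t hlot hthi (by rw [hteq])
      refine h.trans (mul_le_mul_of_nonneg_left ?_ (by positivity))
      rw [hteq]
      refine div_le_div_of_nonneg_left hlo.le (by positivity) ?_
      rcases le_total D lo with hDl | hDl
      · rw [max_eq_right hDl]; nlinarith
      · rw [max_eq_left hDl]; nlinarith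
    · have hteq : t = hi := by rw [ht, min_eq_left h4.le]
      rw [hteq, intervalIntegral.integral_same, abs_zero]; exact htail0
  -- assemble
  have hsplit : ∫ e in lo..hi, w e * X e * deriv (K e) (eb e) =
      (∫ e in lo..v, w e * X e * deriv (K e) (eb e)) + ((∫ e in v..t, w e * X e * deriv (K e) (eb e)) +
        ∫ e in t..hi, w e * X e * deriv (K e) (eb e)) := by
    rw [intervalIntegral.integral_add_adjacent_intervals (hsubI v t hlov hvt hthi) (hsubI t hi hlot hthi le_rfl),
      intervalIntegral.integral_add_adjacent_intervals (hsubI lo v le_rfl hlov hvhi) (hsubI v hi hlov hvhi le_rfl)]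
  rw [hsplit, hV, zero_add]
  refine (abs_add_le _ _).trans ?_
  linarith [hB.trans hBle, hT]

end Summit.HubbardSuperconductivity.HubbardSuperconductivity.Theorems.C4a

end
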